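import Summits.QuantumFields.YangMills.Theorems.UnitScaleTiltProp7CovariantOffKernel
import Summits.QuantumFields.YangMills.Theorems.UnitScaleTiltProp7PinnedFlatComponent
import HarnessLib

/-!
# Route `UnitScaleTilt`, crux K1 «MinimiserStabilityRegPr» (stmt-QuantumFields-19200), line «route-R», stub P — CARD-19200-V3-g11 §6 (S2) as re-aimed by
# OWNER RULING 03:20:20Z (1): **S2′ — THE CURVED LINEAR CORE ON THE LANDAU SLICE, ASSEMBLED MODULO THE CURVED N6 (DISPLAYED)** —
# at an `SU(2)` background with (14) `dist1(U₀(∂p)) ≤ εL^{−2(K−n)}`, for `D^*_{U₀}Y = 0`, the structure rows of the true linearised symmetric average at `U₀`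
# (displayed: covariant straight-line average = coarse Λ-gradient + ε-defect, Λ `(H¹)^*`-bounded) give
# `(1 − 32c_Eε²)·L^{−2(K−n)}Σ_b‖Y(b)‖² ≤ 18·Σ_p‖(D_{U₀}Y)(p)‖²_HS + 384·c_Λ·G`, uniformly in `m`, `n`, `K`

Cell `ym3-torus`, width seat `ym-ust-20520-w2` (g2); sequel of this seat's LOCATED note `S2-CURVED-LOCATED-w2g2.md` (19200 evidence #44, §5 (S2′)) and of (RP-a)
`…Prop7CovariantCurlOfGrad`.  THEOREMS ONLY (0 `def`, 0 `sorry`); `--supports stmt-QuantumFields-19200`, count-neutral.  YM₃ on T³ is a ladder rung (R3), not the Clay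
problem; this is bookkeeping over the tree engine — the curved N6 (the recursion family `Λ^{U₀}` of the TRUE linearised (0.4)-average at `U₀`, its `(H¹)^*`-bound and its
`ε`-defect) is DISPLAYED, not proved; nothing here claims S2, P, the crux or the gap.

WHY THIS SHAPE.  The tree's curved engine `Prop7CovariantCoercivity.sum_normSq_le_curl_sq_add_divB_sq_add_avg_T3` ([B9] Thm 3.11 in `L²` form off the kernel:
`L^{−2k}Σ‖Y‖² ≤ 18(Σ‖D_{U₀}Y‖²_HS + Σ‖D^*_{U₀}Y‖²_HS) + 16(L^{3k}L^{2k})^{−1}L^{−2k}Σ_c‖A^{U₀}_cY‖²`, `216ε ≤ 1`) keeps the covariant STRAIGHT-LINE block average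
`A^{U₀}` as a penalty.  On the Landau slice the divergence term is zero; the constraint `Q(U₀)Y = 0` for the TRUE average enters only through the curved analogue of
★p1's N6 (`Prop7IterLinStructureRec` ∕ `Prop7IterLambdaBound` ∕ `Prop7PinnedConstraintSplit` at `U₀ = 1`): `A^{U₀}_cY = L^{3k}·(Λ(c₊) −_{U₀} Λ(c₋)) + E_c` with
`Σ_y‖Λ(y)‖² ≤ c_Λ·L^k·G` (`G` the covariant gradient energy of `Y` on the blocks) and `Σ_cE_c² ≤ c_E·(L^k)^5·ε²·Σ‖Y‖²` (contour-correction transports: relative defect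
`≤ L^{2k}·εL^{−2k} = ε` per term, `L^{3k}L^k` terms per coarse bond, each fine bond met `≤ L^k` times).  The transported difference costs nothing at a unitary background
(`‖R(Ū)Λ‖ = ‖Λ‖`), so the rows are displayed through the NORM inequality `‖A^{U₀}_cY‖ ≤ L^{3k}(‖Λ(c₊)‖ + ‖Λ(c₋)‖) + E_c` — the weakest form the assembly needs, and
exactly the shape the curved N6 must deliver.  No gauge function appears: the located obstruction of the note (near-commuting modes) is absent on the Landau slice.

WHAT IS PROVED (ns `…Theorems.Prop7CurvedLandauCoercivity`).
* §1 `sum_sq_norm_add_le` — `Σ_c (V(‖Λ c₊‖ + ‖Λ c₋‖) + E_c)² ≤ 8dV²·Σ_y‖Λ y‖² + 2Σ_cE_c²` (`Prop7PinnedFlatCoercivity.sum_pbond_tgt_add_src`).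
* §2 ★★ `sum_normSq_le_curl_sq_of_landau_of_structure_T3` — the title inequality at the d = 3 carrier (`Site (F.P K) 0`, `k = K − n`, `SU(2)`), from the engine by name.
HONEST SCOPE.  The three displayed rows ARE the content of S2′ (M-sized: the curved re-run of N6); `G` is left abstract (intended: `Σ_y E^{U₀}_k(Y)(y) ≤ Σ‖∇^{U₀}Y‖² ≤`
curl² + div² + `2daΣ‖Y‖²` by `Prop7CovariantWeitzenbock`).  S2″ (pinned → Landau) is untouched (L; the note's §5).

References: T. Bałaban, CMP 99 (1985) 389–434 [Balaban1985BackgroundPropagators] (Thm 3.11 p.416); CMP 95 (1984) 17–40 [Balaban1984PropagatorsI] ((1.18)–(1.20) pp.19–20);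
CMP 102 (1985) 277–309 [Balaban1985Variational] ((14) p.280, Prop. 7 p.299).
-/

noncomputable section

open scoped BigOperators Matrix.Norms.L2Operator Matrix

namespace Summit.QuantumFields.YangMills.Theorems.Prop7CurvedLandauCoercivity

open Literature.MathematicalPhysics.QuantumFieldTheory.Balaban1983to89
open Finset B1RG242Torus
open B7Prop1Explicit (treeWord)
open B7Eq78Linearization (conjR)
open B9Eq39Adjoint (curl divB)
open B10Eq27TorusAxialLog (holT unitsField toUField)
open B9TorusCalculus (torusT)
open Summit.QuantumFields.YangMills.Theorems.Prop7CovariantCoercivity (sum_normSq_le_curl_sq_add_divB_sq_add_avg_T3)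
open Summit.QuantumFields.YangMills.Theorems.Prop7PinnedFlatCoercivity (sum_pbond_tgt_add_src)

variable {P : Params} {N : ℕ}

/-! ## §1 The penalty bookkeeping -/

/-- `Σ_c (V(‖Λ c₊‖ + ‖Λ c₋‖) + E_c)² ≤ 8dV²·Σ_y ‖Λ y‖² + 2Σ_c E_c²` (`(u+v)² ≤ 2u² + 2v²` twice, then every site is an end of `2d` bonds). [folklore] -/
theorem sum_sq_norm_add_le {k : ℕ} (V : ℝ) (Λ : Site P k → Matrix (Fin N) (Fin N) ℂ) (E : PBond P k → ℝ) :
    ∑ c : PBond P k, (V * (‖Λ c.tgt‖ + ‖Λ c.src‖) + E c) ^ 2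
      ≤ 8 * P.d * V ^ 2 * ∑ y : Site P k, ‖Λ y‖ ^ 2 + 2 * ∑ c : PBond P k, E c ^ 2 := by
  have hpt : ∀ c : PBond P k, (V * (‖Λ c.tgt‖ + ‖Λ c.src‖) + E c) ^ 2 ≤ 4 * V ^ 2 * (‖Λ c.tgt‖ ^ 2 + ‖Λ c.src‖ ^ 2) + 2 * E c ^ 2 := by
    intro c
    nlinarith [sq_nonneg (V * (‖Λ c.tgt‖ + ‖Λ c.src‖) - E c), sq_nonneg (V * (‖Λ c.tgt‖ - ‖Λ c.src‖)), sq_nonneg V]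
  calc ∑ c : PBond P k, (V * (‖Λ c.tgt‖ + ‖Λ c.src‖) + E c) ^ 2
      ≤ ∑ c : PBond P k, (4 * V ^ 2 * (‖Λ c.tgt‖ ^ 2 + ‖Λ c.src‖ ^ 2) + 2 * E c ^ 2) := Finset.sum_le_sum fun c _ => hpt c
    _ = 4 * V ^ 2 * ∑ c : PBond P k, (‖Λ c.tgt‖ ^ 2 + ‖Λ c.src‖ ^ 2) + 2 * ∑ c : PBond P k, E c ^ 2 := by
        rw [Finset.sum_add_distrib, ← Finset.mul_sum, ← Finset.mul_sum]
    _ = 8 * P.d * V ^ 2 * ∑ y : Site P k, ‖Λ y‖ ^ 2 + 2 * ∑ c : PBond P k, E c ^ 2 := by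
        rw [sum_pbond_tgt_add_src (fun y => ‖Λ y‖ ^ 2)]
        ring

/-! ## §2 ★★ S2′: the curved linear core on the Landau slice, modulo the displayed curved N6 -/

/-- ★★ **S2′ — [B9] THM 3.11 ON THE LANDAU SLICE UNDER THE TRUE-AVERAGE CONSTRAINT, MODULO THE CURVED N6 (d = 3 carrier).**  Let `U₀` be an `SU(2)` background on the finest
torus of run `K` with `dist1(U₀(∂p)) ≤ εL^{−2(K−n)}`, `216ε ≤ 1`, and `Y` an `M₂(ℂ)`-valued bond field in the covariant Landau gauge `D^*_{U₀}Y = 0`.  DISPLAYED (the curved N6,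
to be supplied for `Q(U₀)Y = 0`): a coarse site function `Λ`, defects `E_c` and reals `G, c_Λ, c_E` with `‖A^{U₀}_cY‖ ≤ L^{3(K−n)}(‖Λ(c₊)‖ + ‖Λ(c₋)‖) + E_c`,
`Σ_y‖Λ(y)‖² ≤ c_Λ·L^{K−n}·G`, `Σ_cE_c² ≤ c_E·L^{5(K−n)}·ε²·Σ_b‖Y(b)‖²`.  THEN
`(1 − 32c_Eε²)·L^{−2(K−n)}·Σ_b‖Y(b)‖² ≤ 18·Σ_{x,μ<ν}‖(D_{U₀}Y)(p_{μν}(x))‖²_HS + 384·c_Λ·G` — the `L^{−2k}` coercivity of the curved linearised Wilson Hessian on the constrained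
Landau slice, uniformly in `m`, `n`, `K`, with the averaging penalty paid by the structure rows. [cite: Balaban1985BackgroundPropagators, Thm 3.11 p.416] -/
theorem sum_normSq_le_curl_sq_of_landau_of_structure_T3 (F : T3ContinuumYM3Torus.T3Family) (n K : ℕ)
    (U₀ : GaugeField (F.P K) 0 (Matrix.specialUnitaryGroup (Fin 2) ℂ)) {ε : ℝ} (hε : 0 ≤ ε) (hε1 : 216 * ε ≤ 1)
    (hU : ∀ p : Plaq (F.P K) 0, dist1 (GaugeField.plaqHol U₀ p) ≤ ε * (((F.L : ℝ) ^ (K - n)) ^ 2)⁻¹)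
    (Y : PBond (F.P K) 0 → Matrix (Fin 2) (Fin 2) ℂ)
    (hdiv : ∀ x : Site (F.P K) 0, divB (torusT (F.P K) 0) (fun κ z => unitsField (toUField U₀) ⟨z, κ⟩) (fun κ z => Y ⟨z, κ⟩) x = 0)
    (Λ : Site (F.P K) (K - n) → Matrix (Fin 2) (Fin 2) ℂ) (E : PBond (F.P K) (K - n) → ℝ) {G cΛ cE : ℝ}
    (hA : ∀ c : PBond (F.P K) (K - n),
      ‖∑ r : Fin (F.P K).d → Fin ((F.P K).L ^ (K - n)), ∑ t ∈ range ((F.P K).L ^ (K - n)),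
        conjR (holT (unitsField (toUField U₀)) (Site.fibreSite 0 (K - n) c.src fun _ => ⟨0, pow_pos (F.P K).L_pos (K - n)⟩)
              (treeWord fun ν => ((r ν : ℕ) : ℤ))
            * holT (unitsField (toUField U₀)) (Site.fibreSite 0 (K - n) c.src r) (List.replicate t (c.dir, true)))
          (Y ⟨(fun z : Site (F.P K) 0 => z.shift c.dir)^[t] (Site.fibreSite 0 (K - n) c.src r), c.dir⟩)‖
        ≤ ((F.L : ℝ) ^ (K - n)) ^ 3 * (‖Λ c.tgt‖ + ‖Λ c.src‖) + E c)
    (hΛ : ∑ y : Site (F.P K) (K - n), ‖Λ y‖ ^ 2 ≤ cΛ * (F.L : ℝ) ^ (K - n) * G)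
    (hE : ∑ c : PBond (F.P K) (K - n), E c ^ 2 ≤ cE * ((F.L : ℝ) ^ (K - n)) ^ 5 * ε ^ 2 * ∑ b : PBond (F.P K) 0, ‖Y b‖ ^ 2) :
    (1 - 32 * cE * ε ^ 2) * ((((F.L : ℝ) ^ (K - n)) ^ 2)⁻¹ * ∑ b : PBond (F.P K) 0, ‖Y b‖ ^ 2)
      ≤ 18 * ∑ x : Site (F.P K) 0, ∑ μ : Fin (F.P K).d, ∑ ν : Fin (F.P K).d,
            (if μ < ν then ∑ j : Fin 2, ∑ k : Fin 2,
              ‖(curl (torusT (F.P K) 0) (fun κ z => unitsField (toUField U₀) ⟨z, κ⟩) (fun κ z => Y ⟨z, κ⟩) μ ν x) j k‖ ^ 2 else 0)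
        + 384 * cΛ * G := by
  have hLpos : (0 : ℝ) < (F.L : ℝ) := by have := F.hL.2; exact_mod_cast (by omega : 0 < F.L)
  have hℓ : (0 : ℝ) < (F.L : ℝ) ^ (K - n) := pow_pos hLpos _
  have hd : (F.P K).d = 3 := T3ContinuumYM3Torus.T3Family.P_d F K
  -- the engine, with the divergence term erased
  have heng := sum_normSq_le_curl_sq_add_divB_sq_add_avg_T3 F n K U₀ hε hε1 hU Y
  have hdiv0 : ∑ x : Site (F.P K) 0, ∑ j : Fin 2, ∑ k : Fin 2,
      ‖(divB (torusT (F.P K) 0) (fun κ z => unitsField (toUField U₀) ⟨z, κ⟩) (fun κ z => Y ⟨z, κ⟩) x) j k‖ ^ 2 = 0 := by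
    refine Finset.sum_eq_zero fun x _ => ?_
    rw [hdiv x]
    simp
  have hdpow : ((F.L : ℝ) ^ (K - n)) ^ (F.P K).d = ((F.L : ℝ) ^ (K - n)) ^ 3 := by rw [hd]
  rw [hdiv0, add_zero, hdpow] at heng
  -- the penalty through the displayed rows
  have hAVG : ∑ c : PBond (F.P K) (K - n),
      ‖∑ r : Fin (F.P K).d → Fin ((F.P K).L ^ (K - n)), ∑ t ∈ range ((F.P K).L ^ (K - n)),
        conjR (holT (unitsField (toUField U₀)) (Site.fibreSite 0 (K - n) c.src fun _ => ⟨0, pow_pos (F.P K).L_pos (K - n)⟩)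
              (treeWord fun ν => ((r ν : ℕ) : ℤ))
            * holT (unitsField (toUField U₀)) (Site.fibreSite 0 (K - n) c.src r) (List.replicate t (c.dir, true)))
          (Y ⟨(fun z : Site (F.P K) 0 => z.shift c.dir)^[t] (Site.fibreSite 0 (K - n) c.src r), c.dir⟩)‖ ^ 2
      ≤ 8 * (F.P K).d * (((F.L : ℝ) ^ (K - n)) ^ 3) ^ 2 * ∑ y : Site (F.P K) (K - n), ‖Λ y‖ ^ 2 + 2 * ∑ c : PBond (F.P K) (K - n), E c ^ 2 := by
    refine le_trans ?_ (sum_sq_norm_add_le (((F.L : ℝ) ^ (K - n)) ^ 3) Λ E)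
    refine Finset.sum_le_sum fun c _ => ?_
    have h0 := norm_nonneg (∑ r : Fin (F.P K).d → Fin ((F.P K).L ^ (K - n)), ∑ t ∈ range ((F.P K).L ^ (K - n)),
        conjR (holT (unitsField (toUField U₀)) (Site.fibreSite 0 (K - n) c.src fun _ => ⟨0, pow_pos (F.P K).L_pos (K - n)⟩)
              (treeWord fun ν => ((r ν : ℕ) : ℤ))
            * holT (unitsField (toUField U₀)) (Site.fibreSite 0 (K - n) c.src r) (List.replicate t (c.dir, true)))
          (Y ⟨(fun z : Site (F.P K) 0 => z.shift c.dir)^[t] (Site.fibreSite 0 (K - n) c.src r), c.dir⟩))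
    exact pow_le_pow_left₀ h0 (hA c) 2
  have hd3 : ((F.P K).d : ℝ) = 3 := by rw [hd]; norm_num
  rw [hd3] at hAVG
  -- scalars
  set ℓ : ℝ := (F.L : ℝ) ^ (K - n) with hℓdef
  set SY : ℝ := ∑ b : PBond (F.P K) 0, ‖Y b‖ ^ 2 with hSYdef
  have hSY : 0 ≤ SY := by positivity
  have hSΛ := hΛ
  have hpen : 16 * (((ℓ ^ 3) * ℓ ^ 2)⁻¹ * (ℓ ^ 2)⁻¹) * (8 * 3 * (ℓ ^ 3) ^ 2 * ∑ y : Site (F.P K) (K - n), ‖Λ y‖ ^ 2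
        + 2 * ∑ c : PBond (F.P K) (K - n), E c ^ 2)
      ≤ 384 * cΛ * G + 32 * cE * ε ^ 2 * ((ℓ ^ 2)⁻¹ * SY) := by
    have h1 : 16 * (((ℓ ^ 3) * ℓ ^ 2)⁻¹ * (ℓ ^ 2)⁻¹) * (8 * 3 * (ℓ ^ 3) ^ 2 * ∑ y : Site (F.P K) (K - n), ‖Λ y‖ ^ 2)
        = 384 * ℓ⁻¹ * ∑ y : Site (F.P K) (K - n), ‖Λ y‖ ^ 2 := by
      field_simp
      ring
    have h2 : 16 * (((ℓ ^ 3) * ℓ ^ 2)⁻¹ * (ℓ ^ 2)⁻¹) * (2 * ∑ c : PBond (F.P K) (K - n), E c ^ 2)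
        = 32 * (ℓ ^ 7)⁻¹ * ∑ c : PBond (F.P K) (K - n), E c ^ 2 := by
      field_simp
      ring
    rw [mul_add, h1, h2]
    have h3 : 384 * ℓ⁻¹ * ∑ y : Site (F.P K) (K - n), ‖Λ y‖ ^ 2 ≤ 384 * cΛ * G := by
      calc 384 * ℓ⁻¹ * ∑ y : Site (F.P K) (K - n), ‖Λ y‖ ^ 2 ≤ 384 * ℓ⁻¹ * (cΛ * ℓ * G) :=
            mul_le_mul_of_nonneg_left hSΛ (by positivity)
        _ = 384 * cΛ * G := by field_simp
    have h4 : 32 * (ℓ ^ 7)⁻¹ * ∑ c : PBond (F.P K) (K - n), E c ^ 2 ≤ 32 * cE * ε ^ 2 * ((ℓ ^ 2)⁻¹ * SY) := by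
      calc 32 * (ℓ ^ 7)⁻¹ * ∑ c : PBond (F.P K) (K - n), E c ^ 2 ≤ 32 * (ℓ ^ 7)⁻¹ * (cE * ℓ ^ 5 * ε ^ 2 * SY) :=
            mul_le_mul_of_nonneg_left hE (by positivity)
        _ = 32 * cE * ε ^ 2 * ((ℓ ^ 2)⁻¹ * SY) := by field_simp
    linarith
  have hK : (0 : ℝ) ≤ 16 * (((ℓ ^ 3) * ℓ ^ 2)⁻¹ * (ℓ ^ 2)⁻¹) := by positivity
  have hmain := heng.trans (add_le_add le_rfl (mul_le_mul_of_nonneg_left hAVG hK))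
  -- `hmain : (ℓ²)⁻¹ SY ≤ 18 CURL + 16 K · (24 ℓ⁶ ΣΛ² + 2ΣE²)`
  nlinarith [hmain, hpen]

end Summit.QuantumFields.YangMills.Theorems.Prop7CurvedLandauCoercivity

end
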